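import Summits.QuantumFields.YangMills.Theorems.UnitScaleTiltProp7CoarseKernelRowNeumann
import Summits.QuantumFields.YangMills.Theorems.UnitScaleTiltProp7Kernel133DoorOfKinvRow
import HarnessLib

/-!
# Route `UnitScaleTilt`, crux K1 «MinimiserStabilityRegPr» (stmt-QuantumFields-19200), EX face — K-STOREY, FILE (K5-cone, part B):
# **THE COARSE ENTRY ROW `hKinv` AT THE Π-SLOT FROM THE ONE AT THE η-SLOT AND THE α-SMALL DECAYING ROWS OF `G_π − G₀`** (★p1 g27 CHAIR WORD №34, the cone route):
# `K_π = K₀ + Q_k(G_π − G₀)Q_k†`, `K_π⁻¹ = (1 + K₀⁻¹Q_k(G_π − G₀)Q_k†)⁻¹K₀⁻¹` — a Neumann inverse ON THE COARSE CARRIER whose smallness is an α-window, K-free at the pins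

Cell `ym3-torus` (HUMAN RULING D-0037; rung R3 = SU(2) YM₃ on T³ — NOT d = 4, NOT infinite volume, NOT a mass gap, NOT Clay).  Width seat `ym3-torus-px10` (gen 14; FREE px; the
cone step TAKEN 2026-08-30 12:02Z on CHAIR WORD №34).  THEOREMS ONLY (0 `def`, 0 `sorry`, default heartbeats); `--supports stmt-QuantumFields-19200 --as helper`; count-neutral.

THE OBJECTS (✓`Prop7SectET3CurvedPropagatorsT3`).  `K_x := Q_k ∘ G_x ∘ Q_k†` on the coarse carrier `WL2 ℂ (fun _ : PBond (F.P n) 0 => cB) W₂`, `G_x = GT … a (Δx) U₀` for the two slots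
`Δ^η = DeltaEtaSlot` (x = 0) and `Δ_πᴾ = DeltaPiSlotP … a` (x = π); `KinvT … Δx U₀` is THE inverse of `K_x` on the class `PosOnto … Δx U₀` (✓`Qk_GT_adjoint_KinvT`: `K_x ∘ KinvT_x = 1`; finite
dimension makes it two-sided and unique).  `Q_k`, `Q_k†` do not see the slot, so `K_π − K₀ = Q_k ∘ (G_π − G₀) ∘ Q_k† =: E` (linearity).
THE DISPLAYED LETTERS.  `hKinv`(η): the coarse entry row of `KinvT_η` (`C_K`, rate `μ > 0`) — ✓`Prop7KinvRowOfConjLetters` §2∕§3's OUTPUT text at `Δx := DeltaEtaSlot`; `hΔb`: the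
BLOCK row of the difference `G_π − G₀` — «source supported in block `z` with sup `≤ s` ⟹ `‖toL2⁻¹((G_π − G₀)(toL2 X))(bd)‖ ≤ s·κ·e^{−δ·dc(B bd₋, z)}`» (N6 FILE D4 ★p1
✓-to-be `blockDecay_rows_GTpi_sub_GTeta_of_letters` `.1`, `κ = O(α)`), `δ ≥ 2μ`; `RegPr ε₀` + the two ε-windows (for the tube rows of `Q_k`, `Q_k†` ✓`kernelRow_Qk_of_regPr`∕
✓`kernelRow_adjoint_Qk_of_regPr`); the classes `PosOnto`(Δ^η), `PosOnto`(Δ_πᴾ); ONE window `N·3(2(1+4∕μ))³ < 1`, `N := C_K·C_E·3(2(1+2∕μ))³`,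
`C_E := 9600·e^{2μ+1}·κ·(cB∕c₀)ℓ⁻³·(2(1+1∕μ))³` — at the family scalings `C_K = CK L·(c₀∕cB)ℓ³`, `κ = κ L`: `N = 28800·e^{2μ+1}·CK L·κ L·(2(1+1∕μ))³(2(1+2∕μ))³`, K-FREE and `O(α)`.
THE ARGUMENT.  (1) `(G_π − G₀) ∘ Q_k†` is coarse→fine with row `κ·10(cB∕c₀)ℓ⁻³e^{μ}·(2(1+1∕μ))³` at rate `μ` (px10 g13 ✓`kernelRow_CF_of_blockSup_comp_CF`: block letter after the tube row);
(2) `E = Q_k ∘ (…)` is coarse→coarse with row `C_E` at rate `μ` (✓`kernelRow_comp_outer` with `Q_k`'s tube row at the free rate `μ+1`; the fine volume `3ℓ³·64` eats `Q_k`'s `ℓ⁻³`);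
(3) `B := KinvT_η ∘ E` has row `N` at rate `μ∕2` (part A ✓`kernelRow_CC_comp_CC`); (4) part A ✓`exists_inverse_CC` on `−B`: `W` with `(1 + B)W = 1 = W(1 + B)` and row `1∕(1 − N·3(2(1+4∕μ))³)`
at rate `μ∕4`; (5) part A ✓`rightInverse_eq_of_perturbation`: `KinvT_π = W ∘ KinvT_η` (`K₀KinvT_η = 1`, `K_πKinvT_π = 1` ✓`Qk_GT_adjoint_KinvT`, `K_π = K₀ + E`); (6) `kernelRow_CC_comp_CC`
once more: the `hKinv`(Π) TEXT with `C_K(Π) := C_W·C_K·3(2(1+8∕μ))³` at rate `μ∕8` — the scaling of record `(c₀∕cB)ℓ³` is carried by `C_K` unchanged.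
WHAT IS PROVED (ns `Summit.QuantumFields.YangMills.Theorems.Prop7KinvPiOfCone`).
* ★★ `kernelRow_E_of_blockLetter` — the coarse row of `Q_k ∘ B ∘ Q_k†` for ANY fine `B` with a block letter `(κ, δ)`, `δ ≥ 2μ`: constant `C_E`, rate `μ`.
* ★ `K_mul_KinvT`, ★ `K_add_E_eq` — the identities of (5); `CE_eq` — the `ℓ`-bookkeeping of `C_E`.
* ★★★ `kinvRow_pi_of_kinvRow_eta_of_cone` — MEMBER: the `hKinv`(Π) text of the doors (✓p769611 ∕ ✓`…Kernel137DoorOfKinvEntry` ∕ ✓`…KernelCDoorOfKinvEntry` ∕ the H-KNIT) from the letters above.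
* ★★★ `kinvRow_pi_family_of_cone` — Idx EDITION: cap `α` (windows of record), L-only weights, member couplings `a L i`, ANY thread `Λ`; `hKinv`(η) family at `CK L·((c₀ L∕cB L)·ℓ³)`, rate
  `μ L`; `hΔb` family with L-only `κ L`, rate `δ L ≥ 2μ L`; `hposη`∕`hpos`; ONE L-only window `N(L)·3(2(1+4∕μ L))³ < 1` ⟹ the `hKinv`(Π) FAMILY TEXT of ✓`kernel133_family_of_kinvRow_of_greenBlockSup`
  ∕ H-KNIT `kernel133_family_of_kinvRow_of_piBlockLetters` with `CK L := C_W(L)·CK L·3(2(1+8∕μ L))³` and rate `μ L∕8` — the ℓ's CANCEL in `N(L)` by `field_simp`.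
HYP-SAT (★★OWNER №42).  `hKinv`(η) = (K2-KNIT)'s output (suppliers m₀∕B_G∕δ₃ at η, all landed or ⧗); `hΔb` = D4 (landed-to-be, from D2's letters); classes from (γ) ✓`hco_DeltaEtaSlot_exists`∕
✓`hco_DeltaPiSlotP_exists`; the window is an inequality among L-only letters, inhabited for small `α L` since `κ L = O(α L)`; no conclusion-shaped letter.
HONEST SCOPE.  Row algebra + two operator identities; no estimate of print is proved; nothing of `hKinv`(η)'s inputs, D4's letters, `h133`, the other EX rows, EX or the crux is proved;
the Yang–Mills mass gap is NOT proved.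

References: T. Bałaban, CMP **99** (1985) 389–434 [Balaban1985BackgroundPropagators] ((3.13)–(3.16) p.393, (3.46)–(3.49) pp.398–399, (3.86) p.409, (3.122)–(3.126) p.420,
(3.131)–(3.132) pp.421–422); CMP **96** (1984) 223–250 [Balaban1984PropagatorsII] (§2 (2.61) p.234); CMP **102** (1985) 277–309 [Balaban1985Variational] ((45)–(46) p.285).
-/

set_option autoImplicit false

noncomputable section

open scoped BigOperators Matrix.Norms.L2Operator InnerProductSpace ComplexConjugate

namespace Summit.QuantumFields.YangMills.Theorems.Prop7KinvPiOfCone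

open Literature.MathematicalPhysics.QuantumFieldTheory.Balaban1983to89
open Literature.MathematicalPhysics.QuantumFieldTheory.Balaban1983to89.T3ContinuumYM3Torus
open Literature.MathematicalPhysics.QuantumFieldTheory.Balaban1983to89.T3Thm1Carrier
open T3PrintedRegularMinimiser (RegPr)
open T3PrintedMinimiserExistence (regPr_mono)
open T3PrintedRegularOrbits (sites_eq)
open T3LevelShift (siteShift)
open B9Eq311L2Pairing (WL2)
open B11Eq103H1Complex (BondL2K)
open B5Eq118OneStroke (iterBlockOf)
open Summit.QuantumFields.YangMills.Theorems.Prop7SectET3Transport (periodsT3)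
open Summit.QuantumFields.YangMills.Theorems.Prop7SectET3HilbertLetters (W₂ toL2 toL2B)
open Summit.QuantumFields.YangMills.Theorems.Prop7SectET3WilsonHessian (DeltaEtaSlot)
open Summit.QuantumFields.YangMills.Theorems.Prop7SectET3CurvedPropagators (Qk GT KinvT PosOnto Qk_GT_adjoint_KinvT)
open Summit.QuantumFields.YangMills.Theorems.Prop7SectET3DeltaPiPInv (DeltaPiSlotP)
open Summit.QuantumFields.YangMills.Theorems.Prop7BlockDistanceWeights (tdist_coarse_triangle)
open Summit.QuantumFields.YangMills.Theorems.Prop7CoarseFineKernelRows (kernelRow_comp_outer sum_pbond_exp_neg_tdist_le kernelRow_Qk_of_regPr kernelRow_adjoint_Qk_of_regPr)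
open Summit.QuantumFields.YangMills.Theorems.Prop7Kernel133DoorOfKinvRow (kernelRow_CF_of_blockSup_comp_CF)
open Summit.QuantumFields.YangMills.Theorems.Prop7CoarseKernelRowNeumann (kernelRow_CC_comp_CC kernelRow_CC_neg exists_inverse_CC rightInverse_eq_of_perturbation)

/-! ## §1 ★★ The coarse row of `E = Q_k ∘ B ∘ Q_k†` from a block letter of `B` -/

section Member

variable (F : T3Family) {n K : ℕ} (h : n ≤ K) (c₀ cB : ℝ) [Fact (0 < c₀)] [Fact (0 < cB)]

omit [Fact (0 < cB)] in
/-- The fine volume at rate `1` and the `ℓ`-bookkeeping of the `E`-row: `(5ℓ⁻³e^{μ+1})·(κ·(10(cB∕c₀)ℓ⁻³e^{μ})·P)·(d(L^d)^{K−n}·(2(1+1))³) = 9600·e^{2μ+1}·κ·(cB∕c₀)ℓ⁻³·P`. [folklore] -/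
theorem CE_eq (κ μ P : ℝ) :
    (5 * ((F.L : ℝ) ^ (K - n))⁻¹ ^ 3 * Real.exp (μ + 1)) * (κ * (2 * 5 * (cB / c₀) * ((F.L : ℝ) ^ (K - n))⁻¹ ^ 3 * Real.exp μ) * P)
        * (((F.P K).d : ℝ) * ((((F.P K).L : ℝ) ^ (F.P K).d) ^ (K - n)) * (2 * (1 + 1 / 1)) ^ 3)
      = 9600 * Real.exp (2 * μ + 1) * κ * (cB / c₀) * ((F.L : ℝ) ^ (K - n))⁻¹ ^ 3 * P := by
  have hc₀ : 0 < c₀ := Fact.out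
  have hL0 : (0 : ℝ) < F.L := by exact_mod_cast lt_trans zero_lt_one F.hL.2
  have hℓ : (0 : ℝ) < (F.L : ℝ) ^ (K - n) := pow_pos hL0 _
  have hd : ((F.P K).d : ℝ) = 3 := by rw [show (F.P K).d = 3 from rfl]; norm_num
  have hV : ((((F.P K).L : ℝ) ^ (F.P K).d) ^ (K - n)) = ((F.L : ℝ) ^ (K - n)) ^ 3 := by
    rw [show (F.P K).d = 3 from rfl, show ((F.P K).L : ℝ) = (F.L : ℝ) from by rw [show (F.P K).L = F.L from rfl], ← pow_mul, mul_comm 3 (K - n), pow_mul]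
  have hexp : Real.exp (2 * μ + 1) = Real.exp (μ + 1) * Real.exp μ := by rw [← Real.exp_add]; ring_nf
  rw [hd, hV, hexp]
  field_simp
  ring

/-- ★★ **THE COARSE ROW OF `Q_k ∘ B ∘ Q_k†` FROM A BLOCK LETTER OF `B`**: at `RegPr F n K ε₀ U₀` with the two ε-windows, if `B` (fine → fine) maps every source supported in block `z` with sup `≤ s`
to values `≤ s·κ·e^{−δ·dc(B bd₋, z)}` and `0 < μ`, `2μ ≤ δ`, then for every coarse spike: `‖toL2B⁻¹(Q_k(B(Q_k†(toL2B δ_yZ))))(y′)‖ ≤ C_E·e^{−μ·tdist(ŷ′, ŷ)}·‖Z‖`,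
`C_E = 9600·e^{2μ+1}·κ·(cB∕c₀)ℓ⁻³·(2(1+1∕μ))³`. [cite: Balaban1985BackgroundPropagators, (3.13)–(3.16) p.393, (3.47)–(3.49) pp.398–399, (3.124)–(3.126) p.420; Balaban1984PropagatorsII, (2.61) p.234] -/
theorem kernelRow_E_of_blockLetter {ε₀ : ℝ} (hε₀ : 0 < ε₀) (hε : 10 ^ 10 * (F.L : ℝ) ^ 6 * ε₀ ≤ 1) (hε12 : 10 ^ 12 * (F.L : ℝ) ^ 3 * ε₀ ≤ 1)
    (U₀ : GaugeField (F.P K) 0 (Matrix.specialUnitaryGroup (Fin 2) ℂ)) (hreg : RegPr F n K ε₀ U₀)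
    (B : BondL2K ℂ 3 (periodsT3 F K) c₀ W₂ →ₗ[ℂ] BondL2K ℂ 3 (periodsT3 F K) c₀ W₂) {κ δ μ : ℝ} (hκ : 0 ≤ κ) (hμ : 0 < μ) (hδ : 2 * μ ≤ δ)
    (hB : ∀ (X : PBond (F.P K) 0 → Matrix (Fin 2) (Fin 2) ℂ) (z : Site (F.P K) (K - n)), (∀ b, X b ≠ 0 → iterBlockOf (K - n) b.src = z) →
      ∀ s : ℝ, 0 ≤ s → (∀ b, ‖X b‖ ≤ s) →
        ∀ bd : PBond (F.P K) 0, ‖(toL2 F K c₀).symm (B (toL2 F K c₀ X)) bd‖ ≤ s * κ * Real.exp (-(δ * (Site.tdist (P := F.P K) (iterBlockOf (K - n) bd.src) z : ℝ))))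
    (y : PBond (F.P n) 0) (Z : Matrix (Fin 2) (Fin 2) ℂ) (y' : PBond (F.P n) 0) :
    ‖(toL2B F n cB).symm (Qk F n K h c₀ cB U₀ ((B ∘ₗ LinearMap.adjoint (Qk F n K h c₀ cB U₀)) (toL2B F n cB (Pi.single y Z)))) y'‖
      ≤ (9600 * Real.exp (2 * μ + 1) * κ * (cB / c₀) * ((F.L : ℝ) ^ (K - n))⁻¹ ^ 3 * (2 * (1 + 1 / μ)) ^ 3)
          * Real.exp (-(μ * (Site.tdist (P := F.P K) (siteShift (sites_eq F n K h) y'.src) (siteShift (sites_eq F n K h) y.src) : ℝ))) * ‖Z‖ := by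
  classical
  have hc₀ : 0 < c₀ := Fact.out
  have hcB : 0 < cB := Fact.out
  have hL0 : (0 : ℝ) < F.L := by exact_mod_cast lt_trans zero_lt_one F.hL.2
  -- (1) `B ∘ Q_k†` : coarse → fine, rate `μ`
  have h1 := kernelRow_CF_of_blockSup_comp_CF F h c₀ cB B (LinearMap.adjoint (Qk F n K h c₀ cB U₀)) (r := μ) (ν := μ) (μT := μ)
    hκ (by positivity) hμ.le le_rfl hμ (by linarith) hB (kernelRow_adjoint_Qk_of_regPr F h c₀ cB hε₀ hε hε12 U₀ hreg hμ.le)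
  -- (2) `Q_k ∘ (B ∘ Q_k†)` : coarse → coarse, outer absorption with `Q_k` at rate `μ + 1`
  have h2 := kernelRow_comp_outer (toL2B F n cB) (toL2 F K c₀) (toL2B F n cB) (fun x z : Site (F.P K) (K - n) => (Site.tdist x z : ℝ))
    (fun _ _ => Nat.cast_nonneg _) (tdist_coarse_triangle F) (fun y : PBond (F.P n) 0 => siteShift (sites_eq F n K h) y.src)
    (fun b : PBond (F.P K) 0 => iterBlockOf (K - n) b.src) (fun y : PBond (F.P n) 0 => siteShift (sites_eq F n K h) y.src)
    (B ∘ₗ LinearMap.adjoint (Qk F n K h c₀ cB U₀)) (Qk F n K h c₀ cB U₀) (r := μ) (ν := 1) (μB := μ + 1)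
    (by positivity) (by positivity) hμ.le le_rfl (by linarith) (fun x => sum_pbond_exp_neg_tdist_le F one_pos x) h1
    (kernelRow_Qk_of_regPr F h c₀ cB hε₀ hε hε12 U₀ hreg (μ := μ + 1) (by linarith)) y Z y'
  rw [CE_eq F c₀ cB κ μ] at h2
  exact h2

/-! ## §2 ★ The two identities: `K₀ ∘ KinvT₀ = 1`, `K₀ + E = K_π` -/

/-- ★ **`K_x ∘ KinvT_x = 1` ON THE CLASS** (✓`Qk_GT_adjoint_KinvT` as a `Module.End` identity), any slot. [cite: Balaban1985BackgroundPropagators, (3.126) p.420] -/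
theorem K_mul_KinvT (a : ℝ) (Δx : GaugeField (F.P K) 0 (Matrix.specialUnitaryGroup (Fin 2) ℂ) → (BondL2K ℂ 3 (periodsT3 F K) c₀ W₂ →ₗ[ℂ] BondL2K ℂ 3 (periodsT3 F K) c₀ W₂))
    (U₀ : GaugeField (F.P K) 0 (Matrix.specialUnitaryGroup (Fin 2) ℂ)) (hp : PosOnto F n K h c₀ cB a Δx U₀) :
    (Qk F n K h c₀ cB U₀ ∘ₗ (GT F n K h c₀ cB a Δx U₀ ∘ₗ LinearMap.adjoint (Qk F n K h c₀ cB U₀))) * KinvT F n K h c₀ cB a Δx U₀ = 1 := by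
  refine LinearMap.ext fun v => ?_
  rw [Module.End.mul_apply, Module.End.one_apply, LinearMap.comp_apply, LinearMap.comp_apply]
  exact Qk_GT_adjoint_KinvT hp v

/-- ★ **`K₀ + Q_k(G_π − G₀)Q_k† = K_π`** (linearity; `Q_k`, `Q_k†` slot-free), any two slots. [cite: Balaban1985BackgroundPropagators, (3.131) p.421] -/
theorem K_add_E_eq (a : ℝ) (Δ₀ Δ₁ : GaugeField (F.P K) 0 (Matrix.specialUnitaryGroup (Fin 2) ℂ) → (BondL2K ℂ 3 (periodsT3 F K) c₀ W₂ →ₗ[ℂ] BondL2K ℂ 3 (periodsT3 F K) c₀ W₂))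
    (U₀ : GaugeField (F.P K) 0 (Matrix.specialUnitaryGroup (Fin 2) ℂ)) :
    Qk F n K h c₀ cB U₀ ∘ₗ (GT F n K h c₀ cB a Δ₀ U₀ ∘ₗ LinearMap.adjoint (Qk F n K h c₀ cB U₀))
        + Qk F n K h c₀ cB U₀ ∘ₗ ((GT F n K h c₀ cB a Δ₁ U₀ - GT F n K h c₀ cB a Δ₀ U₀) ∘ₗ LinearMap.adjoint (Qk F n K h c₀ cB U₀))
      = Qk F n K h c₀ cB U₀ ∘ₗ (GT F n K h c₀ cB a Δ₁ U₀ ∘ₗ LinearMap.adjoint (Qk F n K h c₀ cB U₀)) := by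
  rw [← LinearMap.comp_add, ← LinearMap.add_comp, add_sub_cancel]

/-! ## §3 ★★★ The member: `hKinv`(Π) from `hKinv`(η) and the block row of `G_π − G₀` -/

/-- ★★★ **THE CONE STEP, MEMBER**: at `RegPr F n K ε₀ U₀` (two ε-windows), on the classes `PosOnto`(Δ^η) and `PosOnto`(Δ_πᴾ), the coarse entry row `hKinv`(η) (`C_K`, rate `μ > 0`) and the
block row `hΔb` of `G_π − G₀` (`κ`, rate `δ ≥ 2μ`) with the window `N·3(2(1+4∕μ))³ < 1`, `N = C_K·C_E·3(2(1+2∕μ))³`, `C_E = 9600e^{2μ+1}κ(cB∕c₀)ℓ⁻³(2(1+1∕μ))³`, give the coarse entry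
row of `KinvT_π`: `‖toL2B⁻¹(KinvT … a (DeltaPiSlotP … a) U₀ (toL2B δ_yZ))(y′)‖ ≤ (1∕(1 − N·3(2(1+4∕μ))³))·C_K·3(2(1+8∕μ))³·e^{−(μ∕8)·tdist(ŷ′, ŷ)}·‖Z‖` — the `hKinv`(Π) letter of the doors.
[cite: Balaban1985BackgroundPropagators, (3.131)–(3.132) pp.421–422, (3.86) p.409, (3.126) p.420; Balaban1984PropagatorsII, §2] -/
theorem kinvRow_pi_of_kinvRow_eta_of_cone {ε₀ : ℝ} (hε₀ : 0 < ε₀) (hε : 10 ^ 10 * (F.L : ℝ) ^ 6 * ε₀ ≤ 1) (hε12 : 10 ^ 12 * (F.L : ℝ) ^ 3 * ε₀ ≤ 1)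
    (U₀ : GaugeField (F.P K) 0 (Matrix.specialUnitaryGroup (Fin 2) ℂ)) (hreg : RegPr F n K ε₀ U₀) (a : ℝ)
    (hp₀ : PosOnto F n K h c₀ cB a (DeltaEtaSlot F n K c₀) U₀) (hpπ : PosOnto F n K h c₀ cB a (DeltaPiSlotP F n K h c₀ cB a) U₀)
    {CK μ κ δ : ℝ} (hCK : 0 ≤ CK) (hμ : 0 < μ) (hκ : 0 ≤ κ) (hδ : 2 * μ ≤ δ)
    (hKinv : ∀ (y : PBond (F.P n) 0) (Z : Matrix (Fin 2) (Fin 2) ℂ) (y' : PBond (F.P n) 0),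
      ‖(toL2B F n cB).symm (KinvT F n K h c₀ cB a (DeltaEtaSlot F n K c₀) U₀ (toL2B F n cB (Pi.single y Z))) y'‖
        ≤ CK * Real.exp (-(μ * (Site.tdist (P := F.P K) (siteShift (sites_eq F n K h) y'.src) (siteShift (sites_eq F n K h) y.src) : ℝ))) * ‖Z‖)
    (hΔb : ∀ (X : PBond (F.P K) 0 → Matrix (Fin 2) (Fin 2) ℂ) (z : Site (F.P K) (K - n)), (∀ b, X b ≠ 0 → iterBlockOf (K - n) b.src = z) →
      ∀ s : ℝ, 0 ≤ s → (∀ b, ‖X b‖ ≤ s) →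
        ∀ bd : PBond (F.P K) 0, ‖(toL2 F K c₀).symm ((GT F n K h c₀ cB a (DeltaPiSlotP F n K h c₀ cB a) U₀ - GT F n K h c₀ cB a (DeltaEtaSlot F n K c₀) U₀) (toL2 F K c₀ X)) bd‖
          ≤ s * κ * Real.exp (-(δ * (Site.tdist (P := F.P K) (iterBlockOf (K - n) bd.src) z : ℝ))))
    (hsmall : CK * (9600 * Real.exp (2 * μ + 1) * κ * (cB / c₀) * ((F.L : ℝ) ^ (K - n))⁻¹ ^ 3 * (2 * (1 + 1 / μ)) ^ 3) * (3 * (2 * (1 + 2 / μ)) ^ 3)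
      * (3 * (2 * (1 + 4 / μ)) ^ 3) < 1)
    (y : PBond (F.P n) 0) (Z : Matrix (Fin 2) (Fin 2) ℂ) (y' : PBond (F.P n) 0) :
    ‖(toL2B F n cB).symm (KinvT F n K h c₀ cB a (DeltaPiSlotP F n K h c₀ cB a) U₀ (toL2B F n cB (Pi.single y Z))) y'‖
      ≤ ((1 / (1 - CK * (9600 * Real.exp (2 * μ + 1) * κ * (cB / c₀) * ((F.L : ℝ) ^ (K - n))⁻¹ ^ 3 * (2 * (1 + 1 / μ)) ^ 3) * (3 * (2 * (1 + 2 / μ)) ^ 3)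
            * (3 * (2 * (1 + 4 / μ)) ^ 3))) * CK * (3 * (2 * (1 + 8 / μ)) ^ 3))
          * Real.exp (-(μ / 8 * (Site.tdist (P := F.P K) (siteShift (sites_eq F n K h) y'.src) (siteShift (sites_eq F n K h) y.src) : ℝ))) * ‖Z‖ := by
  classical
  have hc₀ : 0 < c₀ := Fact.out
  have hcB : 0 < cB := Fact.out
  have hL0 : (0 : ℝ) < F.L := by exact_mod_cast lt_trans zero_lt_one F.hL.2
  haveI : FiniteDimensional ℂ (WL2 ℂ (fun _ : PBond (F.P n) 0 => cB) W₂) := LinearEquiv.finiteDimensional (toL2B F n cB)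
  -- the letters of the cone
  set Q := Qk F n K h c₀ cB U₀ with hQ
  set Gη := GT F n K h c₀ cB a (DeltaEtaSlot F n K c₀) U₀ with hGη
  set Gπ := GT F n K h c₀ cB a (DeltaPiSlotP F n K h c₀ cB a) U₀ with hGπ
  set Uη := KinvT F n K h c₀ cB a (DeltaEtaSlot F n K c₀) U₀ with hUη
  set Uπ := KinvT F n K h c₀ cB a (DeltaPiSlotP F n K h c₀ cB a) U₀ with hUπ
  set E : WL2 ℂ (fun _ : PBond (F.P n) 0 => cB) W₂ →ₗ[ℂ] WL2 ℂ (fun _ : PBond (F.P n) 0 => cB) W₂ := Q ∘ₗ ((Gπ - Gη) ∘ₗ LinearMap.adjoint Q) with hE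
  set CE : ℝ := 9600 * Real.exp (2 * μ + 1) * κ * (cB / c₀) * ((F.L : ℝ) ^ (K - n))⁻¹ ^ 3 * (2 * (1 + 1 / μ)) ^ 3 with hCE
  have hCE0 : 0 ≤ CE := by rw [hCE]; positivity
  -- conversions of the volume factors
  have e2 : (2 * (1 + 1 / (μ / 2))) = 2 * (1 + 2 / μ) := by field_simp
  have e4 : (2 * (1 + 1 / (μ / 2 - μ / 4))) = 2 * (1 + 4 / μ) := by field_simp; ring
  have e8 : (2 * (1 + 1 / (μ / 8))) = 2 * (1 + 8 / μ) := by field_simp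
  -- (2) the row of `E` at rate `μ`
  have hErow : ∀ (y : PBond (F.P n) 0) (Z : Matrix (Fin 2) (Fin 2) ℂ) (y' : PBond (F.P n) 0),
      ‖(toL2B F n cB).symm (E (toL2B F n cB (Pi.single y Z))) y'‖
        ≤ CE * Real.exp (-(μ * (Site.tdist (P := F.P K) (siteShift (sites_eq F n K h) y'.src) (siteShift (sites_eq F n K h) y.src) : ℝ))) * ‖Z‖ := by
    intro y Z y'
    rw [hE, LinearMap.comp_apply]
    exact kernelRow_E_of_blockLetter F h c₀ cB hε₀ hε hε12 U₀ hreg (Gπ - Gη) hκ hμ hδ hΔb y Z y'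
  -- (3) the row of `B := Uη ∘ E` at rate `μ∕2`
  have hBrow := kernelRow_CC_comp_CC F h cB Uη E (r := μ / 2) (ν := μ / 2) hCK hCE0 (by positivity) (by linarith) (by positivity) (by linarith) hKinv hErow
  rw [e2] at hBrow
  -- (4) the Neumann inverse of `1 + Uη ∘ E` at rate `μ∕4`
  set N : ℝ := CK * CE * (3 * (2 * (1 + 2 / μ)) ^ 3) with hN
  have hN0 : 0 ≤ N := by rw [hN]; positivity
  have hsmall' : N * (3 * (2 * (1 + 1 / (μ / 2 - μ / 4))) ^ 3) < 1 := by rw [e4, hN, hCE]; exact hsmall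
  obtain ⟨W, hW1, hW2, hWrow⟩ := exists_inverse_CC F h cB (-(Uη ∘ₗ E)) (C := N) (μ := μ / 2) (r := μ / 4) hN0 (by positivity) (by linarith) hsmall'
    (kernelRow_CC_neg F h cB (Uη ∘ₗ E) hBrow)
  rw [e4] at hWrow
  -- (5) the identification `Uπ = W ∘ Uη`
  have hK₀ : (Q ∘ₗ (Gη ∘ₗ LinearMap.adjoint Q)) * Uη = 1 := K_mul_KinvT F h c₀ cB a _ U₀ hp₀
  have hKπ : (Q ∘ₗ (Gη ∘ₗ LinearMap.adjoint Q) + E) * Uπ = 1 := by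
    rw [hE, K_add_E_eq F h c₀ cB a]
    exact K_mul_KinvT F h c₀ cB a _ U₀ hpπ
  have hW1' : (1 + Uη * E) * W = 1 := by
    have : (1 : WL2 ℂ (fun _ : PBond (F.P n) 0 => cB) W₂ →ₗ[ℂ] WL2 ℂ (fun _ : PBond (F.P n) 0 => cB) W₂) - -(Uη ∘ₗ E) = 1 + Uη * E := by
      rw [sub_neg_eq_add]; rfl
    rw [← this]; exact hW1
  have hid : Uπ = W * Uη := rightInverse_eq_of_perturbation hK₀ hW1' hKπ
  -- (6) the row of `W ∘ Uη` at rate `μ∕8`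
  have hfin := kernelRow_CC_comp_CC F h cB W Uη (r := μ / 8) (ν := μ / 8) (by rw [hN]; exact div_nonneg one_pos.le (by linarith)) hCK
    (by positivity) (by linarith) (by positivity) (by linarith) hWrow hKinv y Z y'
  rw [e8] at hfin
  have happ : Uπ (toL2B F n cB (Pi.single y Z)) = (W ∘ₗ Uη) (toL2B F n cB (Pi.single y Z)) := by rw [hid]; rfl
  rw [happ]
  refine hfin.trans (le_of_eq ?_)
  rw [hN, hCE]

end Member

/-! ## §4 ★★★ The Idx edition: L-only letters, the scaling of record, ONE K-free window -/

section Family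

/-- ★★★ **THE CONE STEP, Idx EDITION — THE `hKinv`(Π) FAMILY FROM THE `hKinv`(η) FAMILY AND THE `G_π − G₀` BLOCK-ROW FAMILY.**  Cap `α` with the two windows of record; L-only weights
`c₀ cB`; member couplings `a L i`; ANY thread `Λ L i U₀` (S47: Lift); the classes `PosOnto`(Δ^η)∕`PosOnto`(Δ_πᴾ) under the thread; `hKinv`(η) at the SCALING OF RECORD `CK L·((c₀ L∕cB L)·ℓ³)`
and rate `μ L > 0` (✓`Prop7KinvRowOfConjLetters.kinvRow_family_of_coercive_of_conjResolvent`'s OUTPUT at `Δx := DeltaEtaSlot`); the block row of `G_π − G₀` with an L-only `κ L` at rate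
`δ L ≥ 2μ L` (D4 family); ONE L-only window `CK L·(9600e^{2μ L+1}κ L(2(1+1∕μ L))³)·3(2(1+2∕μ L))³·3(2(1+4∕μ L))³ < 1` — the `ℓ`'s of `C_K` and `C_E` CANCEL.  CONCLUSION: the `hKinv`(Π)
FAMILY TEXT of the doors (✓`kernel133_family_of_kinvRow_of_greenBlockSup`, ✓`kernel137_family_of_kinvRow`, ✓`kernelC_family_of_kinvRow_of_greenColumn`, H-KNIT §2) with
`CK L := (1∕(1 − window))·CK L·3(2(1+8∕μ L))³` at the same scaling and rate `μ L∕8`. [cite: Balaban1985BackgroundPropagators, (3.131)–(3.132) pp.421–422, (3.86) p.409; Balaban1985Variational, Thm 1 p.279] -/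
theorem kinvRow_pi_family_of_cone
    (α : ℕ → ℝ) (hα : ∀ L : ℕ, 1 < L → 0 < α L) (hW : ∀ L : ℕ, 1 < L → 10 ^ 10 * (L : ℝ) ^ 6 * α L ≤ 1) (hW' : ∀ L : ℕ, 1 < L → 10 ^ 12 * (L : ℝ) ^ 3 * α L ≤ 1)
    (c₀ cB : ℕ → ℝ) [hc₀ : ∀ L : ℕ, Fact (0 < c₀ L)] [hcB : ∀ L : ℕ, Fact (0 < cB L)] (a : ∀ L : ℕ, Idx L → ℝ)
    (Λ : ∀ (L : ℕ) (i : Idx L), GaugeField (i.1.1.P i.1.2.2) 0 (Matrix.specialUnitaryGroup (Fin 2) ℂ) → Prop)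
    (hposη : ∀ (L : ℕ), 1 < L → ∀ (i : Idx L) (U₀ : GaugeField (i.1.1.P i.1.2.2) 0 (Matrix.specialUnitaryGroup (Fin 2) ℂ)), ∀ ρ : ℝ, RegPr i.1.1 i.1.2.1 i.1.2.2 ρ U₀ → ρ ≤ α L →
      Λ L i U₀ → PosOnto i.1.1 i.1.2.1 i.1.2.2 i.2.2.le (c₀ L) (cB L) (a L i) (DeltaEtaSlot i.1.1 i.1.2.1 i.1.2.2 (c₀ L)) U₀)
    (hpos : ∀ (L : ℕ), 1 < L → ∀ (i : Idx L) (U₀ : GaugeField (i.1.1.P i.1.2.2) 0 (Matrix.specialUnitaryGroup (Fin 2) ℂ)), ∀ ρ : ℝ, RegPr i.1.1 i.1.2.1 i.1.2.2 ρ U₀ → ρ ≤ α L →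
      Λ L i U₀ → PosOnto i.1.1 i.1.2.1 i.1.2.2 i.2.2.le (c₀ L) (cB L) (a L i) (DeltaPiSlotP i.1.1 i.1.2.1 i.1.2.2 i.2.2.le (c₀ L) (cB L) (a L i)) U₀)
    (CK μ κ δ : ℕ → ℝ) (hCK : ∀ L, 1 < L → 0 ≤ CK L) (hμ : ∀ L, 1 < L → 0 < μ L) (hκ : ∀ L, 1 < L → 0 ≤ κ L) (hδ : ∀ L, 1 < L → 2 * μ L ≤ δ L)
    (hKinv : ∀ (L : ℕ), 1 < L → ∀ (i : Idx L) (U₀ : GaugeField (i.1.1.P i.1.2.2) 0 (Matrix.specialUnitaryGroup (Fin 2) ℂ)), ∀ ρ : ℝ, RegPr i.1.1 i.1.2.1 i.1.2.2 ρ U₀ → ρ ≤ α L →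
      Λ L i U₀ → ∀ (y : PBond (i.1.1.P i.1.2.1) 0) (Z : Matrix (Fin 2) (Fin 2) ℂ) (y' : PBond (i.1.1.P i.1.2.1) 0),
        ‖(toL2B i.1.1 i.1.2.1 (cB L)).symm (KinvT i.1.1 i.1.2.1 i.1.2.2 i.2.2.le (c₀ L) (cB L) (a L i) (DeltaEtaSlot i.1.1 i.1.2.1 i.1.2.2 (c₀ L)) U₀
            (toL2B i.1.1 i.1.2.1 (cB L) (Pi.single y Z))) y'‖
          ≤ CK L * ((c₀ L / cB L) * ((L : ℝ) ^ (i.1.2.2 - i.1.2.1)) ^ 3)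
              * Real.exp (-(μ L * (Site.tdist (siteShift (sites_eq i.1.1 i.1.2.1 i.1.2.2 i.2.2.le) y'.src) (siteShift (sites_eq i.1.1 i.1.2.1 i.1.2.2 i.2.2.le) y.src) : ℝ))) * ‖Z‖)
    (hΔb : ∀ (L : ℕ), 1 < L → ∀ (i : Idx L) (U₀ : GaugeField (i.1.1.P i.1.2.2) 0 (Matrix.specialUnitaryGroup (Fin 2) ℂ)), ∀ ρ : ℝ, RegPr i.1.1 i.1.2.1 i.1.2.2 ρ U₀ → ρ ≤ α L →
      Λ L i U₀ → ∀ (X : PBond (i.1.1.P i.1.2.2) 0 → Matrix (Fin 2) (Fin 2) ℂ) (z : Site (i.1.1.P i.1.2.2) (i.1.2.2 - i.1.2.1)),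
        (∀ b, X b ≠ 0 → iterBlockOf (i.1.2.2 - i.1.2.1) b.src = z) → ∀ s : ℝ, 0 ≤ s → (∀ b, ‖X b‖ ≤ s) →
          ∀ bd : PBond (i.1.1.P i.1.2.2) 0, ‖(toL2 i.1.1 i.1.2.2 (c₀ L)).symm ((GT i.1.1 i.1.2.1 i.1.2.2 i.2.2.le (c₀ L) (cB L) (a L i)
              (DeltaPiSlotP i.1.1 i.1.2.1 i.1.2.2 i.2.2.le (c₀ L) (cB L) (a L i)) U₀ - GT i.1.1 i.1.2.1 i.1.2.2 i.2.2.le (c₀ L) (cB L) (a L i) (DeltaEtaSlot i.1.1 i.1.2.1 i.1.2.2 (c₀ L)) U₀)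
              (toL2 i.1.1 i.1.2.2 (c₀ L) X)) bd‖
            ≤ s * κ L * Real.exp (-(δ L * (Site.tdist (P := i.1.1.P i.1.2.2) (iterBlockOf (i.1.2.2 - i.1.2.1) bd.src) z : ℝ))))
    (hwin : ∀ L, 1 < L → CK L * (9600 * Real.exp (2 * μ L + 1) * κ L * (2 * (1 + 1 / μ L)) ^ 3) * (3 * (2 * (1 + 2 / μ L)) ^ 3) * (3 * (2 * (1 + 4 / μ L)) ^ 3) < 1) :
    ∀ (L : ℕ), 1 < L → ∀ (i : Idx L) (U₀ : GaugeField (i.1.1.P i.1.2.2) 0 (Matrix.specialUnitaryGroup (Fin 2) ℂ)), ∀ ρ : ℝ, RegPr i.1.1 i.1.2.1 i.1.2.2 ρ U₀ → ρ ≤ α L →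
      Λ L i U₀ → ∀ (y : PBond (i.1.1.P i.1.2.1) 0) (Z : Matrix (Fin 2) (Fin 2) ℂ) (y' : PBond (i.1.1.P i.1.2.1) 0),
        ‖(toL2B i.1.1 i.1.2.1 (cB L)).symm (KinvT i.1.1 i.1.2.1 i.1.2.2 i.2.2.le (c₀ L) (cB L) (a L i) (DeltaPiSlotP i.1.1 i.1.2.1 i.1.2.2 i.2.2.le (c₀ L) (cB L) (a L i)) U₀
            (toL2B i.1.1 i.1.2.1 (cB L) (Pi.single y Z))) y'‖
          ≤ ((1 / (1 - CK L * (9600 * Real.exp (2 * μ L + 1) * κ L * (2 * (1 + 1 / μ L)) ^ 3) * (3 * (2 * (1 + 2 / μ L)) ^ 3) * (3 * (2 * (1 + 4 / μ L)) ^ 3)))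
              * CK L * (3 * (2 * (1 + 8 / μ L)) ^ 3)) * ((c₀ L / cB L) * ((L : ℝ) ^ (i.1.2.2 - i.1.2.1)) ^ 3)
              * Real.exp (-(μ L / 8 * (Site.tdist (siteShift (sites_eq i.1.1 i.1.2.1 i.1.2.2 i.2.2.le) y'.src) (siteShift (sites_eq i.1.1 i.1.2.1 i.1.2.2 i.2.2.le) y.src) : ℝ))) * ‖Z‖ := by
  intro L hL i U₀ ρ hreg hρ hl y Z y'
  have hFL : (i.1.1.L : ℝ) = (L : ℝ) := by rw [i.2.1]
  have hc₀L : 0 < c₀ L := (hc₀ L).out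
  have hcBL : 0 < cB L := (hcB L).out
  have hL0 : (0 : ℝ) < (L : ℝ) := by exact_mod_cast lt_trans zero_lt_one hL
  have hℓ : (0 : ℝ) < (L : ℝ) ^ (i.1.2.2 - i.1.2.1) := pow_pos hL0 _
  have hregα : RegPr i.1.1 i.1.2.1 i.1.2.2 (α L) U₀ := regPr_mono (F := i.1.1) hρ hreg
  have hεw : 10 ^ 10 * (i.1.1.L : ℝ) ^ 6 * α L ≤ 1 := by rw [hFL]; exact hW L hL
  have hεw' : 10 ^ 12 * (i.1.1.L : ℝ) ^ 3 * α L ≤ 1 := by rw [hFL]; exact hW' L hL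
  -- the scaling of record `t = (c₀∕cB)ℓ³` cancels against `C_E`'s `(cB∕c₀)ℓ⁻³`
  set t : ℝ := (c₀ L / cB L) * ((L : ℝ) ^ (i.1.2.2 - i.1.2.1)) ^ 3 with ht
  have ht0 : 0 < t := by rw [ht]; positivity
  have hCKt : 0 ≤ CK L * t := mul_nonneg (hCK L hL) ht0.le
  have hkey : CK L * t * (9600 * Real.exp (2 * μ L + 1) * κ L * (cB L / c₀ L) * ((i.1.1.L : ℝ) ^ (i.1.2.2 - i.1.2.1))⁻¹ ^ 3 * (2 * (1 + 1 / μ L)) ^ 3)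
      = CK L * (9600 * Real.exp (2 * μ L + 1) * κ L * (2 * (1 + 1 / μ L)) ^ 3) := by
    rw [hFL, ht]
    field_simp
  have hsmall : CK L * t * (9600 * Real.exp (2 * μ L + 1) * κ L * (cB L / c₀ L) * ((i.1.1.L : ℝ) ^ (i.1.2.2 - i.1.2.1))⁻¹ ^ 3 * (2 * (1 + 1 / μ L)) ^ 3)
      * (3 * (2 * (1 + 2 / μ L)) ^ 3) * (3 * (2 * (1 + 4 / μ L)) ^ 3) < 1 := by
    rw [hkey]; exact hwin L hL
  have hmem := kinvRow_pi_of_kinvRow_eta_of_cone i.1.1 i.2.2.le (c₀ L) (cB L) (hα L hL) hεw hεw' U₀ hregα (a L i)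
    (hposη L hL i U₀ ρ hreg hρ hl) (hpos L hL i U₀ ρ hreg hρ hl) hCKt (hμ L hL) (hκ L hL) (hδ L hL)
    (hKinv L hL i U₀ ρ hreg hρ hl) (hΔb L hL i U₀ ρ hreg hρ hl) hsmall y Z y'
  refine hmem.trans (le_of_eq ?_)
  congr 1
  congr 1
  rw [hkey]
  set D : ℝ := 1 / (1 - CK L * (9600 * Real.exp (2 * μ L + 1) * κ L * (2 * (1 + 1 / μ L)) ^ 3) * (3 * (2 * (1 + 2 / μ L)) ^ 3) * (3 * (2 * (1 + 4 / μ L)) ^ 3))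
  ring

end Family

end Summit.QuantumFields.YangMills.Theorems.Prop7KinvPiOfCone

end
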